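import Summits.QuantumFields.YangMills.Theorems.AllWindowsColdBoxBoxHighLineGaussianDeterminant

/-!
# TASK T-S5/U5.4m «Gaussian norm tail» — the RELATIVE χ²-type tail `{β‖Mv‖² ≥ a}` of the Gaussian `exp(−β‖Mv‖²)` on `Fin n → ℝ`
# (planner ym-idea-2 g17, 2026-08-29T17:35:21Z; the second bulk condition `{β‖FA‖² ≤ a}` of `SHELL-BUDGET-S5U5.md` §2(b), i.e. the
# `B₀`-tail of the Laplace sandwich 4k `…LaplaceSandwich`); seat ym-line-fcl-p3 g25.

On the tail set `e^{−β‖Mv‖²} ≤ e^{−a/2}·e^{−(β/2)‖Mv‖²}`, and the `β/2`-Gaussian integrates to `√(2π/β)ⁿ/|det M|` by ✓4a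
`gaussianDeterminantFormula`; so `∫_{a ≤ β‖Mv‖²} e^{−β‖Mv‖²} ≤ e^{−a/2}·√(2π/β)ⁿ/|det M| = e^{−a/2}·2^{n/2}·MAIN` — a RELATIVE bound
(cost `2^{n/2}`, paid by `a ≍ n`).  Integrability of the `β/2`-Gaussian is read off from the nonzero value of its integral
(`Integrable.of_integral_ne_zero`), so nothing beyond 4a is needed.

HONEST LABEL: an S brick of step (1b) of the XL stubs S5 (LINE-19 ⟨24004⟩/⟨24335⟩) / U5 (LINE-20 ⟨24336⟩); T-S5.4, S5, U5 and the three
items are OPEN; the Yang–Mills mass gap is NOT proved by this file; no summit is proved by a line.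
-/

set_option autoImplicit false

noncomputable section

open MeasureTheory Matrix

namespace Summit.QuantumFields.YangMills.Theorems.AllWindowsColdBoxBoxHighLine

/-- T-S5.4m **(Gaussian norm tail; S)**: for an invertible real `n × n` matrix `M`, `β > 0` and `a ≥ 0`,
`∫_{a ≤ β‖Mv‖²} exp(−β ‖M v‖²) dv ≤ e^{−a/2} · (√(2π/β))ⁿ / |det M|` (typed verbatim, planner ym-idea-2 g17 17:35:21Z). -/
def GaussianNormTail : Prop :=
  ∀ (n : ℕ) (M : Matrix (Fin n) (Fin n) ℝ), M.det ≠ 0 → ∀ β : ℝ, 0 < β → ∀ a : ℝ, 0 ≤ a →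
    ∫ v in {v : Fin n → ℝ | a ≤ β * (M.mulVec v ⬝ᵥ M.mulVec v)}, Real.exp (-(β * (M.mulVec v ⬝ᵥ M.mulVec v))) ≤
      Real.exp (-(a / 2)) * Real.sqrt (2 * Real.pi / β) ^ n / |M.det|

/-- The quadratic form `v ↦ ‖Mv‖²` is continuous. -/
theorem continuous_mulVec_dotProduct_self {n : ℕ} (M : Matrix (Fin n) (Fin n) ℝ) :
    Continuous fun v : Fin n → ℝ => M.mulVec v ⬝ᵥ M.mulVec v :=
  (continuous_const.matrix_mulVec continuous_id).dotProduct (continuous_const.matrix_mulVec continuous_id)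

/-- The tail set `{a ≤ β‖Mv‖²}` is measurable (closed). -/
theorem measurableSet_normTail {n : ℕ} (M : Matrix (Fin n) (Fin n) ℝ) (β a : ℝ) :
    MeasurableSet {v : Fin n → ℝ | a ≤ β * (M.mulVec v ⬝ᵥ M.mulVec v)} :=
  measurableSet_le measurable_const (continuous_const.mul (continuous_mulVec_dotProduct_self M)).measurable

/-- Integrability of the Gaussian `exp(−β‖Mv‖²)` for invertible `M`, `β > 0` — read off from ✓`gaussianDeterminantFormula`
(a function with nonzero Bochner integral is integrable). -/
theorem integrable_exp_neg_mul_mulVec_sq {n : ℕ} {M : Matrix (Fin n) (Fin n) ℝ} (hM : M.det ≠ 0) {β : ℝ} (hβ : 0 < β) :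
    Integrable fun v : Fin n → ℝ => Real.exp (-(β * (M.mulVec v ⬝ᵥ M.mulVec v))) := by
  refine Integrable.of_integral_ne_zero ?_
  rw [gaussianDeterminantFormula n M hM β hβ]
  exact (div_pos (pow_pos (Real.sqrt_pos.2 (div_pos Real.pi_pos hβ)) _) (abs_pos.2 hM)).ne'

/-- **T-S5.4m: the Gaussian norm tail.** -/
theorem gaussianNormTail : GaussianNormTail := by
  intro n M hM β hβ a ha
  set S : Set (Fin n → ℝ) := {v | a ≤ β * (M.mulVec v ⬝ᵥ M.mulVec v)} with hS
  set f : (Fin n → ℝ) → ℝ := fun v => Real.exp (-(β * (M.mulVec v ⬝ᵥ M.mulVec v))) with hf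
  set g : (Fin n → ℝ) → ℝ := fun v => Real.exp (-(β / 2 * (M.mulVec v ⬝ᵥ M.mulVec v))) with hg
  have hβ2 : 0 < β / 2 := by positivity
  have hfi : Integrable f := integrable_exp_neg_mul_mulVec_sq hM hβ
  have hgi : Integrable g := integrable_exp_neg_mul_mulVec_sq hM hβ2
  have hgval : ∫ v, g v = Real.sqrt (2 * Real.pi / β) ^ n / |M.det| := by
    rw [hg, gaussianDeterminantFormula n M hM (β / 2) hβ2, div_div_eq_mul_div, mul_comm Real.pi 2]
  -- pointwise on the tail set: `e^{−βQ} ≤ e^{−a/2} e^{−(β/2)Q}`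
  have hpt : ∀ v ∈ S, f v ≤ Real.exp (-(a / 2)) * g v := by
    intro v hv
    have hv' : a ≤ β * (M.mulVec v ⬝ᵥ M.mulVec v) := hv
    rw [hf, hg]
    dsimp only
    rw [← Real.exp_add]
    exact Real.exp_le_exp.2 (by linarith)
  calc ∫ v in S, f v ≤ ∫ v in S, Real.exp (-(a / 2)) * g v :=
        setIntegral_mono_on hfi.integrableOn (hgi.const_mul _).integrableOn (measurableSet_normTail M β a) hpt
    _ = Real.exp (-(a / 2)) * ∫ v in S, g v := integral_const_mul _ _
    _ ≤ Real.exp (-(a / 2)) * ∫ v, g v := by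
        refine mul_le_mul_of_nonneg_left (setIntegral_le_integral hgi (ae_of_all _ fun v => (Real.exp_pos _).le))
          (Real.exp_pos _).le
    _ = Real.exp (-(a / 2)) * Real.sqrt (2 * Real.pi / β) ^ n / |M.det| := by rw [hgval, mul_div_assoc, mul_div_assoc]

end Summit.QuantumFields.YangMills.Theorems.AllWindowsColdBoxBoxHighLine

end
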